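import Literature.NumberTheory.EllipticCurves.TowerLocalH1CartesianProofs
import HarnessLib

/-!
# Torsion compatible families of the `H¹`-tower of a presented tower have the exponent of the invariants
# (theorems only)

`Proofs` file (theorems only; no definition, no named fact, no instance, no `sorry`), in the currency of
`TowerLocalH1LiftExactProofs` / `TowerConnectingKernelLiftableProofs`: a tower of discrete `Γ_F`-modules
`ρ j : DiscreteGaloisModule F (W j)` presented by ONE two-index family `f a b : W a → W b` (reductions for `b ≤ a`, the
injective `×p^{b-a}` for `a ≤ b`) with the identities `hid/hcomp/hinj/hsurj/hex/hpow`, and the short exact rows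
`isSES_of_exact ρ f hinj hsurj hex j d : 0 → W j → W (j+d) → W d → 0`.

The limit right-kernel argument of Howard's H.4 descent (`Tower.pow_smul_eq_zero_of_forall_pairing_eq_zero`, file
`TowerLimitPairingPerfectProofs`, x10b-p1-w8) asks for the binder

  (hc)  `∀ η ∈ compatibleFamilies red′, (∃ b, p ^ b • η = 0) → p ^ c • η = 0`

— «the torsion compatible families of the `H¹`-tower have bounded exponent `p^c`».  This file derives it from a UNIFORM
bound on the module invariants `H⁰(F, W d)` (all `d`), which is what the arithmetic supplies (cell `pub/bsd-print-x9`,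
brick (B4) `ZpExtensionEisensteinOrdinaryInvariantsBoundProofs`: at `w ∣ p` the invariants of Howard's Eisenstein levels,
of their ordinary sub-twists and of their quotients are killed by `p`, uniformly in the level):

* **`Tower.map_up_apply_eq_zero_of_pow_smul_eq_zero`** — if `η` is compatible and `p^b • η = 0` then every component
  `η j` dies under `H¹(f j (j+b))` (`η j = H¹(f (j+b) j) η (j+b)` and `f j (j+b) ∘ f (j+b) j = p^b`);
* **`Tower.pow_smul_eq_zero_of_mem_compatibleFamilies_of_forall_invariants`** — (hc): hence `η j = δ₀^{(j,b)} u` for an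
  invariant `u` of `W b` (exactness at `H¹(F, W j)`), and `p^c • η j = δ₀ (p^c • u) = 0`.

Nothing arithmetic is proved here; no summit statement is proved; BSD is not proved by any of this.
Seat `bsd-line-x10b-p1-w5` g2 (brick (B4′)).

References: B. Howard, Compositio Math. 140 (2004), §1.3 H.4 and Def. 3.2.6 (arXiv:1202.6340 p. 7 L78–82, p. 16);
J.-P. Serre, *Galois Cohomology* (1997), I §2.2 (long exact sequence, limits of finite modules); J. S. Milne,
*Arithmetic Duality Theorems* (2006), I Cor. 2.3; NSW (2008), (1.3.2)–(1.3.3).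
-/

set_option autoImplicit false

noncomputable section

open CategoryTheory Field
open scoped ContRepresentation

universe u

namespace Literature.NumberTheory.EllipticCurves

namespace Tower

open Literature.NumberTheory.GaloisRepresentations

variable {F : Type u} [Field F]
variable {W : ℕ → Type u} [∀ j, AddCommGroup (W j)] [∀ j, TopologicalSpace (W j)]
  [∀ j, DiscreteTopology (W j)]
variable (ρ : ∀ j, DiscreteGaloisModule F (W j))
variable (f : ∀ a b, (ρ a).toContRepresentation →ⁱL (ρ b).toContRepresentation)

/-- **A `p^b`-torsion compatible family dies under `H¹(×p^b)` componentwise**: if `η` is compatible for the reductions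
`H¹(f (j+1) j)` and `p^b • η = 0`, then `H¹(f j (j+b)) (η j) = 0` for every `j` — because
`η j = H¹(f (j+b) j) (η (j+b))` and `f j (j+b) ∘ f (j+b) j` is multiplication by `p^b` on `W (j+b)`.
[cite: SerreGaloisCohomology1997, Ch. I §2.2] [cite: Howard2004HeegnerKolyvagin, Def. 1.1.3 (arXiv p. 5: the morphisms of Quot(T))] -/
theorem map_up_apply_eq_zero_of_pow_smul_eq_zero (hid : ∀ a (w : W a), f a a w = w)
    (hcomp : ∀ a b c, c ≤ b → b ≤ a → ∀ w : W a, f b c (f a b w) = f a c w)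
    (p : ℕ) (hpow : ∀ ℓ n (w : W (ℓ + n)), f ℓ (ℓ + n) (f (ℓ + n) ℓ w) = p ^ n • w)
    {η : Π j, galoisCohomology (ρ j) 1}
    (hη : η ∈ compatibleFamilies (H := fun j ↦ galoisCohomology (ρ j) 1) (fun j ↦ galoisCohomology.map (f (j + 1) j) 1))
    {b : ℕ} (hb : p ^ b • η = 0) (j : ℕ) :
    galoisCohomology.map (f j (j + b)) 1 (η j) = 0 := by
  have hjb : galoisCohomology.map (f (j + b) j) 1 (η (j + b)) = η j :=
    map_apply_eq_of_mem ρ f hid hcomp hη (Nat.le_add_right j b)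
  rw [← hjb, galoisCohomology.map_map_of_comp_apply (f (j + b) j) (f j (j + b))
    (DiscreteGaloisModule.scalarIntertwining (ρ (j + b)) (DiscreteGaloisModule.isScalarLinear_int _) ((p ^ b : ℕ) : ℤ))
    (fun w ↦ by rw [DiscreteGaloisModule.scalarIntertwining_apply, natCast_zsmul, hpow j b w]),
    map_natCastIntertwining_eq_nsmul]
  have h := congrFun hb (j + b)
  rwa [Pi.smul_apply, Pi.zero_apply] at h

/-- **(hc): torsion compatible families have the exponent of the invariants.**  If `p^c` kills the `Γ_F`-invariants of
`W d` for EVERY `d`, then every compatible family `η` of the `H¹`-tower with `p^b • η = 0` for some `b` satisfies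
`p^c • η = 0`: each component `η j` dies under `H¹(f j (j+b))`, hence is a connecting class `δ₀^{(j,b)} u` of an invariant
`u` of `W b` (exactness of the long exact sequence of `0 → W j → W (j+b) → W b → 0` at `H¹(F, W j)`), and
`p^c • δ₀ u = δ₀ (p^c • u) = 0`.  This is VERBATIM the binder `hc` of `Tower.pow_smul_eq_zero_of_forall_pairing_eq_zero`
(the right kernel of the limit pairing is `p^c`-torsion). [cite: Howard2004HeegnerKolyvagin, §1.3 H.4 and Def. 3.2.6 (arXiv p. 7 L78–82, p. 16)]
[cite: MilneADT2006, Ch. I Cor. 2.3] [cite: SerreGaloisCohomology1997, Ch. I §2.2] -/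
theorem pow_smul_eq_zero_of_mem_compatibleFamilies_of_forall_invariants (hid : ∀ a (w : W a), f a a w = w)
    (hcomp : ∀ a b c, c ≤ b → b ≤ a → ∀ w : W a, f b c (f a b w) = f a c w)
    (hinj : ∀ ℓ n, Function.Injective (f ℓ (ℓ + n)))
    (hsurj : ∀ ℓ n, Function.Surjective (f (ℓ + n) n))
    (hex : ∀ ℓ n (y : W (ℓ + n)), f (ℓ + n) n y = 0 ↔ ∃ x, f ℓ (ℓ + n) x = y)
    (p : ℕ) (hpow : ∀ ℓ n (w : W (ℓ + n)), f ℓ (ℓ + n) (f (ℓ + n) ℓ w) = p ^ n • w)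
    {c : ℕ} (hc : ∀ (d : ℕ) (u : W d), (∀ g : absoluteGaloisGroup F, ρ d g u = u) → p ^ c • u = 0)
    (η : Π j, galoisCohomology (ρ j) 1)
    (hη : η ∈ compatibleFamilies (H := fun j ↦ galoisCohomology (ρ j) 1) (fun j ↦ galoisCohomology.map (f (j + 1) j) 1))
    (hb : ∃ b : ℕ, p ^ b • η = 0) :
    p ^ c • η = 0 := by
  obtain ⟨b, hb⟩ := hb
  funext j
  rw [Pi.smul_apply, Pi.zero_apply]
  -- `η j` dies under `H¹(×p^b)`
  have hup : cohomologyMap (TopRep.ofHom ⟨(f j (j + b)).toContinuousLinearMap, (f j (j + b)).isIntertwining'⟩ :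
      (ρ j).toTopRep ⟶ (ρ (j + b)).toTopRep) 1 (η j) = 0 := by
    rw [← galoisCohomology.map_eq_cohomologyMap_apply]
    exact map_up_apply_eq_zero_of_pow_smul_eq_zero ρ f hid hcomp p hpow hη hb j
  -- exactness at `H¹(F, W j)`: `η j = δ₀ u` for an invariant `u` of `W b`
  obtain ⟨u, hu⟩ := (isSES_of_exact ρ f hinj hsurj hex j b).exists_δ₀_eq_of_map_one_eq_zero (η j) hup
  have hpu : p ^ c • u = 0 := Subtype.ext (by
    rw [AddSubmonoidClass.coe_nsmul, ZeroMemClass.coe_zero]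
    exact hc b (u : W b) (fun g ↦ u.2 g))
  rw [← hu]
  exact (map_nsmul (isSES_of_exact ρ f hinj hsurj hex j b).δ₀ (p ^ c) u).symm.trans (by rw [hpu, map_zero]; rfl)

/-- (hc) with the bound given on the invariants SUBMODULE (`(ρ d).toTopRep.ρ.invariants`, the source of `δ₀`).
[cite: Howard2004HeegnerKolyvagin, §1.3 H.4 (arXiv p. 7 L78–82)] [cite: MilneADT2006, Ch. I Cor. 2.3] -/
theorem pow_smul_eq_zero_of_mem_compatibleFamilies_of_forall_mem_invariants (hid : ∀ a (w : W a), f a a w = w)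
    (hcomp : ∀ a b c, c ≤ b → b ≤ a → ∀ w : W a, f b c (f a b w) = f a c w)
    (hinj : ∀ ℓ n, Function.Injective (f ℓ (ℓ + n)))
    (hsurj : ∀ ℓ n, Function.Surjective (f (ℓ + n) n))
    (hex : ∀ ℓ n (y : W (ℓ + n)), f (ℓ + n) n y = 0 ↔ ∃ x, f ℓ (ℓ + n) x = y)
    (p : ℕ) (hpow : ∀ ℓ n (w : W (ℓ + n)), f ℓ (ℓ + n) (f (ℓ + n) ℓ w) = p ^ n • w)
    {c : ℕ} (hc : ∀ (d : ℕ) (u : (ρ d).toTopRep.ρ.invariants), p ^ c • u = 0)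
    (η : Π j, galoisCohomology (ρ j) 1)
    (hη : η ∈ compatibleFamilies (H := fun j ↦ galoisCohomology (ρ j) 1) (fun j ↦ galoisCohomology.map (f (j + 1) j) 1))
    (hb : ∃ b : ℕ, p ^ b • η = 0) :
    p ^ c • η = 0 :=
  pow_smul_eq_zero_of_mem_compatibleFamilies_of_forall_invariants ρ f hid hcomp hinj hsurj hex p hpow
    (fun d u hu ↦ by
      have h := congrArg Subtype.val (hc d ⟨u, hu⟩)
      rwa [AddSubmonoidClass.coe_nsmul, ZeroMemClass.coe_zero] at h)
    η hη hb

end Tower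

end Literature.NumberTheory.EllipticCurves

end
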